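import Summits.QuantumFields.BalabanUV.T4Continuum.Support.NE7SliceInitialStateNL
import Summits.QuantumFields.BalabanUV.T4Continuum.Support.NE7SliceIterationStateFactsNL0
import HarnessLib

/-!
# [(R1″) FRAME-FREE PORT — memo ROAD-G103 §6: VERBATIM `NE7SliceInitialStateNL` with row NE3's `rightInvW` replaced by `NE7FrameFreeRightInverse.rightInvW0` (`dirIter R₀ = id`, `framePotW R₀ = 0` exactly),
# constants `supC ↦ supC0`, `supCurlC ↦ supCurlC0`, one extra def-parameter `hE`; right-inverse-independent lemmas are imported from `NE7SliceInitialStateNL` BY NAME, not restated.]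
# NE7SliceInitialStateNL0 — THE NEAR-REPRESENTATIVE IS AN ADMISSIBLE INITIAL STATE OF THE (S1) ITERATION ON THE NONLINEAR FRAME TARGET (memo ROAD-G103 §3, (R1′), file (B2)-7):
# `NE7SliceInitialState` VERBATIM with the datum `h(u₀) = 0` replaced by `h̃(u₀) = −P(u₀)`, `‖P(u₀)‖ ≤ C_Γ·(M·2b)²` (the sup letter at radius `2b`): `‖φ̃(u₀)‖ ≤ (3+12d)M·2b + 2C_Γ(2Mb)²`,
# `‖T̃(u₀)‖ ≤ ẽ_E`, `‖curl_W T̃(u₀)‖ ≤ c̃_E`, and `D̃f(u₀) ≤ (ẽ_E + s_E) + (frameC·M·ẽ_E + C_Γ(2Mb)²)∕M` — every product `M·ẽ_E`, `M²·c̃_E`, `C_Γ(2Mb)²` k-free when `b ≍ ε∕M`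

Cell `pub-balaban`, rung (B)+1 sub-cell t4, lineage `b2b-balaban-t4-ne7-p1`, generation 103 (CRUX PROVER NE7 #1 = OWNER of BINDER row NE7).  Memo `t4/b2b-balaban-t4-ne7-p1-g103/ROAD-G103.md` §3.
The chart∕size∕corner facts of `u₀` are `NE7SliceInitialState.init_chart ∕ init_norm_repLog_le ∕ init_cornerLog ∕ init_corner ∕ init_sizePair ∕ init_weighted_size` BY NAME; the NL working-region facts
are `NE7SliceIterationStateFactsNL0` (B7's Prop-4 regime for `W`, `U′` at radius `2b` displayed); the split is `NE7SliceStepContraction.split_error_sized` with datum `h̃(u₀)` of size `C_Γ(2Mb)²`,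
transferred to the chosen split by `NE7SliceSplitUnique.slice_split_unique`.
WHAT ([folklore]; 0 def, 0 sorry).  `init_norm_frameDefect_le`, `init_norm_effCornerLog_le`, **`init_norm_coarseDatumNL_le`**, **`init_norm_tangentPartNL0_le`**, **`init_norm_curlAt_tangentPartNL0_le`**,
**`init_sliceDefectNL0_le`**.
HONEST FRAMING (page 1): bookkeeping over landed letters, (L) displayed; nothing of Bałaban's asserted; NOT the orbit, NOT (S1)-NL, NOT NE7; spine 0∕9; finite T⁴ rung (B)+1 — NOT infinite volume, NOT
mass gap, NOT BetaPertH, NOT Clay (continuum YM on T⁴ ⇐ BetaPertH ∧ nine spine estimates, 0/9 proved).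
-/

set_option autoImplicit false

open scoped BigOperators Matrix.Norms.L2Operator
open NormedSpace Finset

namespace Summit.QuantumFields.BalabanUV.T4Continuum.NE7SliceInitialStateNL0

open Literature.MathematicalPhysics.QuantumFieldTheory.Balaban1983to89
open B7Prop1Explicit B7Prop2Explicit B7Prop3Flat MatrixLog
open T4AveragingDeficitWall (IsUnitaryCfg IsSkewDir SmallField vary Ad curlAt)
open T4AveragingDeficitWallBoundary (IsPeriodicCfg periodBox)
open AveragingDeficitPeriodicCounting (IsPeriodicDir)
open AveragingDeficitTwoLevelPrep (prop1Radius)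
open AveragingDeficitMultiLevelPrep (cavgIter LevelSmall tower cavgIter_unitary_small)
open BlockAveragePushDirGauge (gaugeDir)
open BlockAverageCurrent (smallField_gaugeAct)
open NE3EnergyShapes (IsUnitarySite IsPeriodicSite)
open NE3TangentCovariantTower (dirIter framePotW)
open NE3CovariantBlockMean (bmeanIterW)
open NE3RightInverseSupLetters (frameC supC norm_gaugeDir_le_two_mul)
open NE3HatInvCurlLetters (supCurlC)
open NE3QbarIterCovLiftPrep (cruxC)
open NE7FrameFreeRightInverse (rightInvW0 supC0 supCurlC0 supC0_nonneg norm_rightInvW0_le norm_curlAt_rightInvW0_le)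
open NE3LinearisedAverageSup (curvSum norm_dirIter_le_sup)
open NE3CurlOfGaugeDir (curlAt_sub)
open NE7MeanZeroGaugeSliceW (energyBlockLandauW)
open NE7SliceSplitUnique (slice_split_unique)
open NE7SliceStepContraction (split_error_sized)
open NE7SliceStepErrorField (norm_curlAt_le_of_plaq)
open SpreadLift (loopRad)
open NE7SliceIterationState (repLog cornerLog coarseDatum sizePair siteSup_le bondSup_le)
open NE7SliceIterationStateFacts (repLog_skew repLog_periodic)
open NE7SliceIterationStateNL0
open NE7SliceIterationStateNL (frameDefect effCornerLog coarseDatumNL coarseDatumNL_eq effCornerLog_add_frameDefect)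
open NE7SliceIterationStateFactsNL0
open NE7SliceInitialStateNL (init_norm_frameDefect_le init_norm_effCornerLog_le init_norm_coarseDatumNL_le)
open NE7SliceIterationStateFactsNL (relPert_repLog_eq relPert_repLog_mem_unitary relPert_repLog_periodic pdev_relPert_mul_le frameDefect_skew frameDefect_periodic
  norm_frameDefect_le effCornerLog_skew effCornerLog_periodic norm_effCornerLog_le coarseDatumNL_skew_periodic)
open NE7SliceInitialState (init_chart init_norm_repLog_le init_cornerLog init_corner init_norm_coarseDatum_le init_norm_curlAt_repLog_le)

noncomputable section

variable {d : ℕ} {n : Type*} [Fintype n] [DecidableEq n]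

section Init

variable [Nonempty n] {L : ℕ} (hL : 2 ≤ L) (k : ℕ) {W : Site d → Fin d → (Matrix n n ℂ)ˣ} {x : ℝ} (hWu : IsUnitaryCfg W) (hx : 0 ≤ x) (hs : LevelSmall d L k x)
  (hWx : SmallField W x) (N : ℕ) [NeZero N] (hθ : cruxC d L * (((L : ℝ) ^ (k + 1)) ^ 2 * x) < 1)
  (hE : 4 * (d : ℝ) ^ 2 * ((L : ℝ) ^ (k + 1) - 1) ^ 2 * x + 16 * d * loopRad d L ((prop1Radius d L)^[k] x) ≤ 1 / 2) (U' : Site d → Fin d → (Matrix n n ℂ)ˣ)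
  (hWP : IsPeriodicCfg W ((tower L N (k + 1) : ℕ) : ℤ)) (hU'u : IsUnitaryCfg U') (hU'P : IsPeriodicCfg U' ((tower L N (k + 1) : ℕ) : ℤ))
  {u₀ : Site d → (Matrix n n ℂ)ˣ} (hu₀ : IsUnitarySite u₀) (hu₀P : IsPeriodicSite u₀ ((tower L N (k + 1) : ℕ) : ℤ))
  (hpin : ∀ z : Site d, u₀ (((L : ℤ) ^ (k + 1)) • z) = 1)
  {b : ℝ} (hb : ∀ (y : Site d) (κ : Fin d), ‖(((W y κ)⁻¹ * gaugeAct u₀ U' y κ : (Matrix n n ℂ)ˣ) : Matrix n n ℂ) - 1‖ ≤ b) (hb64 : b ≤ 1 / 64)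
  -- B7's Prop-4 regime at level `k+1` for `W` and `U′` at the radius `2b`
  (hd : 1 ≤ d) {α₀ αP x' : ℝ} (hα : 0 < α₀) (hα3 : C0 d * α₀ ≤ 1 / 3) (hα4 : 4 * α₀ ≤ c2' d L) (h52 : pdev W < α₀ * (((L : ℝ) ^ (k + 1))⁻¹) ^ 2)
  (hsmall : Real.exp (4 * (800 * ((d : ℝ) + 1) ^ 2 * ((d : ℝ) + 4)) * α₀) * (1 + 8 * (131072 * ((d : ℝ) + 1) ^ 2) * ((L : ℝ) ^ (k + 1) * (2 * b))) ≤ 2)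
  (hc₃ : 2 * ((L : ℝ) ^ (k + 1) * (2 * b)) ≤ c3 d L) (h100 : 100 * ((d : ℝ) * L * ((L : ℝ) ^ (k + 1) * (2 * b))) ≤ 1)
  (hC16 : 16 * (131072 * ((d : ℝ) + 1) ^ 2) * ((L : ℝ) ^ (k + 1) * (2 * b)) ≤ 1) (hsm : 2048 * (d : ℝ) * ((L : ℝ) ^ (k + 1) * (2 * b)) ≤ 1)
  (hαP : 0 < αP) (hαP3 : C0 d * αP ≤ 1 / 3) (hαP2 : 2 * αP ≤ c2' d L) (hx'0 : 0 ≤ x') (hU'x : SmallField U' x') (hx'P : x' < αP * (((L : ℝ) ^ (k + 1))⁻¹) ^ 2)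

/-! ## §1 The frame defect and the effective corner logs at `u₀` -/



/-! ## §2 The NL coarse datum, tangent part, its curl, and the NL defect at `u₀` -/


include hWP hU'u hU'P hu₀ hu₀P hpin hb hb64 hd hα hα3 hα4 h52 hsmall hc₃ h100 hC16 hsm hαP hαP3 hαP2 hx'0 hU'x hx'P in
/-- **`‖T̃(u₀)‖ ≤ ẽ_E := 2b + supC∕(M(1−θ))·((3+12d)M·2b + 2C_Γ(2Mb)²)`**. [folklore] -/
theorem init_norm_tangentPartNL0_le (hA : curvSum d L (k + 1) x ≤ 2 / 3 * L) (hε : ((L : ℝ) ^ (k + 1)) ^ 2 * x ≤ 1) (y : Site d) (μ : Fin d) :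
    ‖tangentPartNL0 hL k hWu hx hs hWx N hθ hE U' u₀ y μ‖
      ≤ 2 * b + supC0 d L / ((L : ℝ) ^ (k + 1) * (1 - cruxC d L * (((L : ℝ) ^ (k + 1)) ^ 2 * x)))
        * ((3 + 12 * (d : ℝ)) * (L : ℝ) ^ (k + 1) * (2 * b) + 2 * ((56 * ((d : ℝ) * L) ^ 2 + 16 * (131072 * ((d : ℝ) + 1) ^ 2) * ((d : ℝ) * L)) * ((L : ℝ) ^ (k + 1) * (2 * b)) ^ 2)) := by
  have hb0 : 0 ≤ b := (norm_nonneg _).trans (hb y μ)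
  have hX8 : ∀ y κ, ‖repLog W U' u₀ y κ‖ ≤ 1 / 8 := fun y κ => (init_norm_repLog_le U' hb hb64 y κ).trans (by linarith only [hb64])
  have hh8 : ∀ z, ‖cornerLog L k u₀ z‖ ≤ 1 / 8 := fun z => by rw [init_cornerLog k hpin z, norm_zero]; norm_num
  have hφ := (coarseDatumNL_skew_periodic hL k hWu hx hs hWx N U' hWP hU'u hU'P hu₀ hu₀P (init_chart U' hb hb64) hX8 (init_corner k hpin) hh8
    hd hα hα3 hα4 h52 (by positivity) (init_norm_repLog_le U' hb hb64) hsmall hc₃ hsm hαP hαP3 hαP2 hx'0 hU'x hx'P).1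
  have hN := norm_rightInvW0_le hL k hWu hx hs hWx N hθ hE hφ hε (by positivity)
    (init_norm_coarseDatumNL_le hL k hWu hx hs hWx N U' hWP hU'u hU'P hu₀ hu₀P hpin hb hb64 hd hα hα3 hα4 h52 hsmall hc₃ h100 hC16 hA) y μ
  simp only [tangentPartNL0, normalPartNL0_eq hL k hWu hx hs hWx N hθ hE U' hφ]
  exact (norm_sub_le _ _).trans (add_le_add (init_norm_repLog_le U' hb hb64 y μ) hN)

include hWP hU'u hU'P hu₀ hu₀P hpin hb hb64 hd hα hα3 hα4 h52 hsmall hc₃ h100 hC16 hsm hαP hαP3 hαP2 hx'0 hU'x hx'P in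
/-- **THE CURL OF `T̃(u₀)`**: `‖curl_W T̃(u₀)‖ ≤ c̃_E := (x + x′ + 48(2b)²) + supCurlC∕(M²(1−θ))·((3+12d)M·2b + 2C_Γ(2Mb)²)` for `μ ≠ ν`. [folklore] -/
theorem init_norm_curlAt_tangentPartNL0_le (hA : curvSum d L (k + 1) x ≤ 2 / 3 * L) (hε : ((L : ℝ) ^ (k + 1)) ^ 2 * x ≤ 1) (z : Site d) {μ ν : Fin d} (hμν : μ ≠ ν) :
    ‖curlAt W (tangentPartNL0 hL k hWu hx hs hWx N hθ hE U' u₀) z μ ν‖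
      ≤ (x + x' + 48 * (2 * b) ^ 2) + supCurlC0 d L / (((L : ℝ) ^ (k + 1)) ^ 2 * (1 - cruxC d L * (((L : ℝ) ^ (k + 1)) ^ 2 * x)))
        * ((3 + 12 * (d : ℝ)) * (L : ℝ) ^ (k + 1) * (2 * b) + 2 * ((56 * ((d : ℝ) * L) ^ 2 + 16 * (131072 * ((d : ℝ) + 1) ^ 2) * ((d : ℝ) * L)) * ((L : ℝ) ^ (k + 1) * (2 * b)) ^ 2)) := by
  have hb0 : 0 ≤ b := (norm_nonneg _).trans (hb z μ)
  have hX8 : ∀ y κ, ‖repLog W U' u₀ y κ‖ ≤ 1 / 8 := fun y κ => (init_norm_repLog_le U' hb hb64 y κ).trans (by linarith only [hb64])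
  have hh8 : ∀ z, ‖cornerLog L k u₀ z‖ ≤ 1 / 8 := fun z => by rw [init_cornerLog k hpin z, norm_zero]; norm_num
  have hφ := (coarseDatumNL_skew_periodic hL k hWu hx hs hWx N U' hWP hU'u hU'P hu₀ hu₀P (init_chart U' hb hb64) hX8 (init_corner k hpin) hh8
    hd hα hα3 hα4 h52 (by positivity) (init_norm_repLog_le U' hb hb64) hsmall hc₃ hsm hαP hαP3 hαP2 hx'0 hU'x hx'P).1
  have hNc := norm_curlAt_rightInvW0_le hL k hWu hx hs hWx N hθ hE hφ hε (by positivity)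
    (init_norm_coarseDatumNL_le hL k hWu hx hs hWx N U' hWP hU'u hU'P hu₀ hu₀P hpin hb hb64 hd hα hα3 hα4 h52 hsmall hc₃ h100 hC16 hA) z hμν
  have hXc := init_norm_curlAt_repLog_le hWu hWx U' hU'u hu₀ hb hb64 hU'x z hμν
  have e : tangentPartNL0 hL k hWu hx hs hWx N hθ hE U' u₀ = fun y κ => repLog W U' u₀ y κ - rightInvW0 hL k hWu hx hs hWx N hθ hE hφ y κ := by
    funext y κ; simp only [tangentPartNL0, normalPartNL0_eq hL k hWu hx hs hWx N hθ hE U' hφ]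
  rw [e, curlAt_sub]
  exact (norm_sub_le _ _).trans (add_le_add hXc hNc)

include hWP hU'u hU'P hu₀ hu₀P hpin hb hb64 hd hα hα3 hα4 h52 hsmall hc₃ h100 hC16 hsm hαP hαP3 hαP2 hx'0 hU'x hx'P in
/-- **THE NL DEFECT OF THE NEAR-REPRESENTATIVE**: with `ẽ_E`, `c̃_E` the displayed sup and curl sizes of `T̃(u₀)` and `ẽ_c := C_Γ(M·2b)²` (the size of the datum `h̃(u₀) = −P(u₀)`), on the class with
`θ_P ≤ 1∕2`, (L) displayed as `hLet` (`K ≥ 0`, `16Kd·M²x ≤ 1∕2`), `M²x ≤ 1`, `curvSum ≤ 2L∕3`: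
`D̃f(u₀) ≤ (ẽ_E + s_E) + (frameC·M·ẽ_E + ẽ_c)∕M`, `s_E := 2KM·c̃_E + 8K(M²x)(frameC·M·ẽ_E + ẽ_c)∕M + 16Kd(M²x)ẽ_E`. [folklore] -/
theorem init_sliceDefectNL0_le
    (hθP : 4 * (d : ℝ) ^ 2 * ((L : ℝ) ^ (k + 1) - 1) ^ 2 * x + 16 * d * loopRad d L ((prop1Radius d L)^[k] x)
      + 4 * d * ((d : ℝ) - 1) * ((L : ℝ) ^ (k + 1) - 1) ^ 2 * x ≤ 1 / 2)
    {K : ℝ} (hK : 0 ≤ K) (hKε : 16 * K * d * (((L : ℝ) ^ (k + 1)) ^ 2 * x) ≤ 1 / 2)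
    (hLet : ∀ Y : Site d → Fin d → Matrix n n ℂ, Y ∈ energyBlockLandauW (d := d) (n := n) L N (k + 1) W →
      ∀ B : ℝ, (∀ (z : Site d) (μ ν : Fin d), μ ≠ ν → ‖curlAt W Y z μ ν‖ ≤ B) → ∀ (y : Site d) (κ : Fin d), ‖Y y κ‖ ≤ K * (L : ℝ) ^ (k + 1) * B)
    (hε : ((L : ℝ) ^ (k + 1)) ^ 2 * x ≤ 1) (hA : curvSum d L (k + 1) x ≤ 2 / 3 * L)
    {eE cE ec : ℝ}
    (heE : 2 * b + supC0 d L / ((L : ℝ) ^ (k + 1) * (1 - cruxC d L * (((L : ℝ) ^ (k + 1)) ^ 2 * x)))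
        * ((3 + 12 * (d : ℝ)) * (L : ℝ) ^ (k + 1) * (2 * b) + 2 * ((56 * ((d : ℝ) * L) ^ 2 + 16 * (131072 * ((d : ℝ) + 1) ^ 2) * ((d : ℝ) * L)) * ((L : ℝ) ^ (k + 1) * (2 * b)) ^ 2)) ≤ eE)
    (hcE : (x + x' + 48 * (2 * b) ^ 2) + supCurlC0 d L / (((L : ℝ) ^ (k + 1)) ^ 2 * (1 - cruxC d L * (((L : ℝ) ^ (k + 1)) ^ 2 * x)))
        * ((3 + 12 * (d : ℝ)) * (L : ℝ) ^ (k + 1) * (2 * b) + 2 * ((56 * ((d : ℝ) * L) ^ 2 + 16 * (131072 * ((d : ℝ) + 1) ^ 2) * ((d : ℝ) * L)) * ((L : ℝ) ^ (k + 1) * (2 * b)) ^ 2)) ≤ cE)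
    (hec : (56 * ((d : ℝ) * L) ^ 2 + 16 * (131072 * ((d : ℝ) + 1) ^ 2) * ((d : ℝ) * L)) * ((L : ℝ) ^ (k + 1) * (2 * b)) ^ 2 ≤ ec) :
    sliceDefectNL0 hL k hWu hx hs hWx N hθ hE U' u₀
      ≤ (eE + (2 * K * (L : ℝ) ^ (k + 1) * cE + 8 * K * (((L : ℝ) ^ (k + 1)) ^ 2 * x) * (frameC d L * (L : ℝ) ^ (k + 1) * eE + ec) / (L : ℝ) ^ (k + 1)
          + 16 * K * d * (((L : ℝ) ^ (k + 1)) ^ 2 * x) * eE))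
        + (frameC d L * (L : ℝ) ^ (k + 1) * eE + ec) / (L : ℝ) ^ (k + 1) := by
  haveI : NeZero L := ⟨by omega⟩
  have hd0 : 0 < d := hd
  have hP1 : 1 ≤ tower L N (k + 1) := Nat.one_le_iff_ne_zero.mpr (NeZero.ne _)
  have hN1 : 1 ≤ N := Nat.one_le_iff_ne_zero.mpr (NeZero.ne _)
  have hM : 0 < (L : ℝ) ^ (k + 1) := by positivity
  have hb0 : 0 ≤ b := (norm_nonneg _).trans (hb 0 ⟨0, hd0⟩)
  have h1θ : 0 < 1 - cruxC d L * (((L : ℝ) ^ (k + 1)) ^ 2 * x) := by linarith only [hθ]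
  have hsC : 0 ≤ supC0 d L := by
    unfold supC0 supC NE3RightInverseSupLetters.corrC NE3RightInverseSupLetters.frameC; have := NE3QbarIterCovLiftPrep.liftC_nonneg d; positivity
  have hsCC : 0 ≤ supCurlC0 d L := by
    unfold supCurlC0 supCurlC supC NE3RightInverseSupLetters.corrC NE3RightInverseSupLetters.frameC; have := NE3QbarIterCovLiftPrep.liftC_nonneg d; positivity
  have heE0 : 0 ≤ eE := le_trans (by positivity) heE
  have hcE0 : 0 ≤ cE := le_trans (by positivity) hcE
  have hec0 : 0 ≤ ec := le_trans (by positivity) hec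
  have hX8 : ∀ y κ, ‖repLog W U' u₀ y κ‖ ≤ 1 / 8 := fun y κ => (init_norm_repLog_le U' hb hb64 y κ).trans (by linarith only [hb64])
  have hh8 : ∀ z, ‖cornerLog L k u₀ z‖ ≤ 1 / 8 := fun z => by rw [init_cornerLog k hpin z, norm_zero]; norm_num
  have hchart := init_chart U' hb hb64 (u₀ := u₀)
  have hcorner := init_corner k hpin (u₀ := u₀)
  have hXb : ∀ y κ, ‖repLog W U' u₀ y κ‖ ≤ 2 * b := init_norm_repLog_le U' hb hb64
  have h2b0 : 0 ≤ 2 * b := by positivity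
  -- the chosen split at `u₀`
  obtain ⟨hζ1s, hζ1P, hY1, hsplit1, hmean1⟩ := splitNL0_holds hL k hWu hx hs hWx N hθ hE U' hWP hU'u hU'P hu₀ hu₀P hchart hX8 hcorner hh8
    hd hα hα3 hα4 h52 h2b0 hXb hsmall hc₃ hsm hαP hαP3 hαP2 hx'0 hU'x hx'P
  -- the sized split of `E := T̃(u₀)` against the datum `j := h̃(u₀)`
  have hEs := tangentPartNL0_skew hL k hWu hx hs hWx N hθ hE U' hWP hU'u hU'P hu₀ hu₀P hchart hX8 hcorner hh8 hd hα hα3 hα4 h52 h2b0 hXb hsmall hc₃ hsm hαP hαP3 hαP2 hx'0 hU'x hx'P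
  have hEP := tangentPartNL0_periodic hL k hWu hx hs hWx N hθ hE U' hWP hU'u hU'P hu₀ hu₀P hchart hX8 hcorner hh8 hd hα hα3 hα4 h52 h2b0 hXb hsmall hc₃ hsm hαP hαP3 hαP2 hx'0 hU'x hx'P
  have hdir := dirIter_tangentPartNL0 hL k hWu hx hs hWx N hθ hE U' hWP hU'u hU'P hu₀ hu₀P hchart hX8 hcorner hh8 hd hα hα3 hα4 h52 h2b0 hXb hsmall hc₃ hsm hαP hαP3 hαP2 hx'0 hU'x hx'P
  have hjs : ∀ z, effCornerLog L k W U' u₀ z ∈ skewAdjoint (Matrix n n ℂ) :=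
    effCornerLog_skew hL k hWu hx hs hWx N U' hWP hU'u hU'P hu₀ hu₀P hchart hX8 hcorner hh8 hd hα hα3 hα4 h52 h2b0 hXb hsmall hc₃ hsm hαP hαP3 hαP2 hx'0 hU'x hx'P
  have hjP : ∀ (z : Site d) (i : Fin d), effCornerLog L k W U' u₀ (z + (N : ℤ) • e i) = effCornerLog L k W U' u₀ z :=
    effCornerLog_periodic hL k hWu hx hs hWx N U' hWP hU'u hU'P hu₀ hu₀P hchart hX8
  have hj0 : ∀ z, ‖effCornerLog L k W U' u₀ z‖ ≤ ec := fun z =>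
    (init_norm_effCornerLog_le hL k hWu U' hpin hb hb64 hd hα hα3 hα4 h52 hsmall hc₃ h100 hC16 z).trans hec
  have hEle : ∀ y κ, ‖tangentPartNL0 hL k hWu hx hs hWx N hθ hE U' u₀ y κ‖ ≤ eE := fun y κ =>
    (init_norm_tangentPartNL0_le hL k hWu hx hs hWx N hθ hE U' hWP hU'u hU'P hu₀ hu₀P hpin hb hb64 hd hα hα3 hα4 h52 hsmall hc₃ h100 hC16 hsm hαP hαP3 hαP2 hx'0 hU'x hx'P hA hε y κ).trans heE
  have hcEle : ∀ (z : Site d) (μ ν : Fin d), μ ≠ ν → ‖curlAt W (tangentPartNL0 hL k hWu hx hs hWx N hθ hE U' u₀) z μ ν‖ ≤ cE := fun z μ ν hμν =>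
    (init_norm_curlAt_tangentPartNL0_le hL k hWu hx hs hWx N hθ hE U' hWP hU'u hU'P hu₀ hu₀P hpin hb hb64 hd hα hα3 hα4 h52 hsmall hc₃ h100 hC16 hsm hαP hαP3 hαP2 hx'0 hU'x hx'P hA hε z hμν).trans hcE
  obtain ⟨ζE, YE, hζEs, hζEP, hYE, hsplitE, hmeanE, hmE, -, hδE, -⟩ :=
    split_error_sized hd0 hL k hWu hWP hx hs hWx hθP hK hKε hLet hEs hEP hjs hjP hdir heE0 hcE0 hEle hcEle hj0
  -- uniqueness: the chosen split has the same `gaugeDir`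
  have huniq := slice_split_unique k hWP (T := tangentPartNL0 hL k hWu hx hs hWx N hθ hE U' u₀) hYE hY1 hζEs hζEP hζ1s hζ1P hsplitE hsplit1
    (funext fun z => by rw [hmeanE z, hmean1 z])
  have hgD : ∀ y μ, ‖gaugeDir W (gaugeFunNL0 hL k hWu hx hs hWx N hθ hE U' u₀) y μ‖
      ≤ eE + (2 * K * (L : ℝ) ^ (k + 1) * cE + 8 * K * (((L : ℝ) ^ (k + 1)) ^ 2 * x) * (frameC d L * (L : ℝ) ^ (k + 1) * eE + ec) / (L : ℝ) ^ (k + 1)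
          + 16 * K * d * (((L : ℝ) ^ (k + 1)) ^ 2 * x) * eE) := fun y μ => by
    rw [← huniq.2 y μ]; exact hδE y μ
  have hfC : 0 ≤ frameC d L := by unfold frameC; positivity
  have hsE0 : 0 ≤ eE + (2 * K * (L : ℝ) ^ (k + 1) * cE + 8 * K * (((L : ℝ) ^ (k + 1)) ^ 2 * x) * (frameC d L * (L : ℝ) ^ (k + 1) * eE + ec) / (L : ℝ) ^ (k + 1)
      + 16 * K * d * (((L : ℝ) ^ (k + 1)) ^ 2 * x) * eE) := by positivity
  unfold sliceDefectNL0 frameMismatchNL0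
  exact add_le_add (bondSup_le hP1 hsE0 hgD) (div_le_div_of_nonneg_right (siteSup_le hN1 hmE) hM.le)

end Init

end

end Summit.QuantumFields.BalabanUV.T4Continuum.NE7SliceInitialStateNL0
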